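import Summits.ResolutionOfSingularities.ResolutionOfSingularities.Theorems.PurelyInseparableDim4DirectrixAtMostTwo
import Summits.ResolutionOfSingularities.ResolutionOfSingularities.Theorems.PurelyInseparableDim4ShapeLemma3
import Literature.AlgebraicGeometry.Resolution.PointBlowupDirectrixBoundary
import HarnessLib
import HarnessLib.Audit.Tags

/-!
# Purely inseparable dim 4 — on the cone, `ē ≡ 1` tails are FREE tails; F4-I(3,3) ⟺ FT(3,3) ∧ E2(3,3)

F4-I(3,3) (WORD #35 (b)), continued.  By `IsolatedBand.noIsolatedTrap_three_three_of_band_and_cone`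
(p655773) and `Directrix.isolated_cone_chain_eventually_one_or_two` (p656477), an infinite isolated
`Step0 3` chain in characteristic `3` is either a BAND chain (`ord₀ ≡ 4` from index `1`) or has a CONE
tail (`ord₀ ≡ 3`) on which `ē = dim_K A(F_3)` is eventually constant, `≡ 1` or `≡ 2`.

This file shows that the case `ē ≡ 1` is ALREADY INSIDE THE FREE-TAIL LEMMA (FT) that the band needs
(`FreeTail.NoIsolatedFreeTailAt`, CARD I-7-2): along a witnessed chain, if `ē(c k) = ē(c (k+1)) = 1` at
states of order `p`, the successor's additive LINE is transversal to the new exceptional hyperplane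
`{x_{j k} = 0}` ([CJS 2020] Thm. 9.3 ⟹ Def. 3.13 (2), kernel fact
`CentreBlowup.isVeryNearPoint_iff_isTransversal`), the next direction lies on that line
(`Directrix.direction_mem_additiveSubspace`, [CJS 2020] Thm. 3.14 in the frame), so its
`x_{j k}`-coordinate is non-zero: step `k + 1` is FREE, never satellite
(`not_isSatellite_of_finrank_eq_one`, `forall_not_isSatellite_of_finrank_eq_one`).  Hence
(`no_isolated_cone_chain_one_of_freeTail`) FT(p,p) excludes every isolated cone chain with `ē ≡ 1`
— the frame form of [CJS 2020] Cor. 5.37 (`e = 1`: "a sequence of blowups in closed points, finite")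
needs no separate citation — and

* `noIsolatedTrap_three_three_iff_freeTail_and_coneTwo` —
  **`NoIsolatedTrap 3 3 ⟺ NoIsolatedFreeTailAt 3 3 ∧ E2(3,3)`**, where E2(3,3) (stated inline, no new
  definition) = «no infinite isolated `Step0 3` chain all of whose states have `ord₀ F = 3` and
  `dim_K A(F_3) = 2`» — exactly the `e_x = ē_x = 2` territory of [CJS 2020] Def. 5.38 / Thm. 5.40
  (LNM 2270: 6.38 / 6.40), the band's (SH3) being the landed `FreeTail.shapeLemma3`.

OURS (frame reading); nothing here proves FT, E2, `NoIsolatedTrap 3 3`, or resolution in dimension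
`≥ 4` / characteristic `p`.  Supports stmt-ResolutionOfSingularities-16155 (helper).
-/

set_option linter.dupNamespace false -- mandated namespace of this single-conjunct summit

namespace Summit.ResolutionOfSingularities.ResolutionOfSingularities.Theorems.PIDim4

namespace IsolatedBand

open MvPolynomial Finset
open Literature.AlgebraicGeometry.Resolution
open Literature.AlgebraicGeometry.Resolution.Hauser2010
open Literature.AlgebraicGeometry.Resolution.HauserPerlega2019
open Literature.Barriers.ResolutionOfSingularities
open PointBlowup (direction gradSpan additiveSubspace boundarySubspace IsTransversal)

variable {K : Type} [Field K]

/-! ## 1. A witnessed chain is a `Step0` chain -/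

/-- The witnesses of `FreeTail.IsWitnessedChain` reassemble into `Step0` edges. [OURS] -/
theorem step0_of_isWitnessedChain [DecidableEq K] {q : ℕ} {c : ℕ → State K} {j : ℕ → Fin 4}
    {b : ℕ → Fin 4 → K} (hw : FreeTail.IsWitnessedChain q c j b) (k : ℕ) :
    Step0 q (c k) (c (k + 1)) :=
  ⟨(hw k).1, j k, b k, Finset.mem_univ _, (hw k).2.1, (hw k).2.2.1, (hw k).2.2.2.1, (hw k).2.2.2.2⟩

/-! ## 2. One edge with `ē(s⁺) = ē(s)`: transversality to the exceptional hyperplane -/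

/-- **Very near ⟹ transversal, frame form**: along a point-centre edge `s ⟶ s⁺ = step p univ j b s`
from a state of order `p` with `∇F_p ≠ 0`, if `ē(s⁺) = ē(s)` then `A([F⁺]_p)` is transversal to the
exceptional hyperplane `{w_j = 0}` ([CJS 2020] Def. 3.13 (2) "very near" and Thm. 9.3, kernel fact
`CentreBlowup.isVeryNearPoint_iff_isTransversal` with `S` = all variables). [OURS · frame reading]
[cite: CossartJannsenSaito2020, Def. 3.13 (2) and Thm. 9.3] -/
theorem isTransversal_of_finrank_eq [DecidableEq K] (p : ℕ) [Fact p.Prime] [CharP K p]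
    {s : State K} (hord : ordZero s.F = p) (hgrad : gradSpan (initialForm s.F) ≠ ⊥) {j : Fin 4}
    {b : Fin 4 → K} (hbj : b j = 0) (heq : CentreBlowup.IsEquimultiplePoint p Finset.univ j b s)
    (he : Module.finrank K (additiveSubspace (initialForm (CentreBlowup.step p Finset.univ j b s).F)) =
      Module.finrank K (additiveSubspace (initialForm s.F))) :
    IsTransversal (additiveSubspace (initialForm (CentreBlowup.step p Finset.univ j b s).F)) {j} := by
  rw [Directrix.additiveSubspace_initialForm_step p hord hgrad hbj heq] at he ⊢
  have hvery : CentreBlowup.IsVeryNearPoint p Finset.univ j b s := ⟨heq, he⟩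
  have h := (CentreBlowup.isVeryNearPoint_iff_isTransversal p Finset.univ j (Finset.mem_univ j) b
    hbj (fun i hi => absurd (Finset.mem_univ i) hi) s hord
    (Directrix.le_ordAlong_univ_of_ordZero_eq hord) heq).mp hvery
  have hN : insert j (Finset.univ : Finset (Fin 4))ᶜ = {j} := by simp
  rw [hN] at h
  exact h

/-- On a LINE transversal to `{w_j = 0}` every non-zero vector has `w_j ≠ 0`. [folklore] -/
theorem apply_ne_zero_of_isTransversal_singleton {T : Submodule K (Fin 4 → K)} {j : Fin 4}
    (hT : IsTransversal T {j}) (h1 : Module.finrank K T = 1) {w : Fin 4 → K} (hw : w ∈ T)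
    (hw0 : w ≠ 0) : w j ≠ 0 := by
  intro hwj
  unfold PointBlowup.IsTransversal at hT
  rw [Finset.card_singleton, h1] at hT
  have h0 : Module.finrank K ↥(T ⊓ boundarySubspace K {j}) = 0 := by omega
  have hbot : T ⊓ boundarySubspace K {j} = ⊥ := Submodule.finrank_eq_zero.mp h0
  have hmem : w ∈ T ⊓ boundarySubspace K {j} :=
    Submodule.mem_inf.mpr ⟨hw, PointBlowup.mem_boundarySubspace.mpr fun i hi => by
      rw [Finset.mem_singleton] at hi
      rw [hi]
      exact hwj⟩
  rw [hbot, Submodule.mem_bot] at hmem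
  exact hw0 hmem

/-! ## 3. `ē ≡ 1` tails are free -/

/-- **One step**: along a witnessed chain, if `c k` has order `p`, `∇ ≠ 0`, and
`ē(c k) = ē(c (k+1)) = 1`, then step `k + 1` is NOT satellite with respect to the hyperplane
`{x_{j k} = 0}` created at step `k`: the direction of step `k + 1` lies on the additive line of
`c (k+1)` ([CJS 2020] Thm. 3.14, frame: `Directrix.direction_mem_additiveSubspace`), which is
transversal to that hyperplane (§2), so its `x_{j k}`-coordinate `b (k+1) (j k)` is non-zero whenever
the chart changes. [OURS · frame reading] [cite: CossartJannsenSaito2020, Thm. 3.14 and Thm. 9.3] -/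
theorem not_isSatellite_of_finrank_eq_one [DecidableEq K] (p : ℕ) [Fact p.Prime] [CharP K p]
    {c : ℕ → State K} {j : ℕ → Fin 4} {b : ℕ → Fin 4 → K} (hw : FreeTail.IsWitnessedChain p c j b)
    {k : ℕ} (hord : ordZero (c k).F = p) (hgrad : gradSpan (initialForm (c k).F) ≠ ⊥)
    (hek : Module.finrank K (additiveSubspace (initialForm (c k).F)) = 1)
    (hek1 : Module.finrank K (additiveSubspace (initialForm (c (k + 1)).F)) = 1) :
    ¬ FreeTail.IsSatellite j b k := by
  rintro ⟨hjj, hb0⟩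
  obtain ⟨-, hbj, heq, -, hck⟩ := hw k
  obtain ⟨-, hbj1, heq1, -, -⟩ := hw (k + 1)
  have htr : IsTransversal (additiveSubspace (initialForm (c (k + 1)).F)) {j k} := by
    rw [hck] at hek1 ⊢
    exact isTransversal_of_finrank_eq p hord hgrad hbj heq (hek1.trans hek.symm)
  have hord1 : ordZero (c (k + 1)).F = p := by
    rw [hck]
    exact Directrix.ordZero_step_eq p hord hgrad hbj heq
  have hdir : direction (j (k + 1)) (b (k + 1)) ∈ additiveSubspace (initialForm (c (k + 1)).F) :=
    Directrix.direction_mem_additiveSubspace p hord1 hbj1 heq1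
  have hne := apply_ne_zero_of_isTransversal_singleton htr hek1 hdir
    (Directrix.direction_ne_zero _ _)
  rw [direction, Function.update_of_ne (Ne.symm hjj)] at hne
  exact hne hb0

/-- **Tail version**: along a witnessed `Step0 p` chain, if from some index `k₀ ≥ 1` on the order is `p`
at `k₀` (hence forever, `ordZero_eq_of_le`) and `ē ≡ 1`, then EVERY step from `k₀` on is free.
[OURS · frame reading] [cite: CossartJannsenSaito2020, Thm. 3.14 and Thm. 9.3] -/
theorem forall_not_isSatellite_of_finrank_eq_one [DecidableEq K] (p : ℕ) [Fact p.Prime] [CharP K p]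
    {c : ℕ → State K} {j : ℕ → Fin 4} {b : ℕ → Fin 4 → K} (hw : FreeTail.IsWitnessedChain p c j b)
    {k₀ : ℕ} (hk₀ : 1 ≤ k₀) (hord : ordZero (c k₀).F = p)
    (he : ∀ k, k₀ ≤ k → Module.finrank K (additiveSubspace (initialForm (c k).F)) = 1) :
    ∀ k, k₀ ≤ k → ¬ FreeTail.IsSatellite j b k := by
  have hc : ∀ k, Step0 p (c k) (c (k + 1)) := step0_of_isWitnessedChain hw
  intro k hk
  have hordk : ordZero (c k).F = p := ordZero_eq_of_le p hc hk₀ hord hk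
  have hclean : HauserPerlega.IsClean p (c k).F := by
    obtain ⟨k', rfl⟩ := Nat.exists_eq_add_of_le' (hk₀.trans hk)
    exact isClean_of_step0 (hc k')
  exact not_isSatellite_of_finrank_eq_one p hw hordk
    (Directrix.gradSpan_initialForm_ne_bot_of_isClean p hordk hclean) (he k hk) (he (k + 1) (by omega))

/-! ## 4. Assembly: FT kills the `ē ≡ 1` cone; F4-I(3,3) ⟺ FT(3,3) ∧ E2(3,3) -/

/-- **FT(p,p) excludes every isolated cone chain with `ē ≡ 1`** (the frame form of [CJS 2020] Cor. 5.37,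
`e = 1`): choose witnesses, all steps from `k₀` on are free (§3), and the free-tail lemma produces a
non-isolated state. [OURS · conditional on FT] [cite: CossartJannsenSaito2020, Cor. 5.37] -/
theorem no_isolated_cone_chain_one_of_freeTail (p : ℕ) [Fact p.Prime] [CharP K p] [DecidableEq K]
    (hFT : FreeTail.NoIsolatedFreeTailAt p p) {c : ℕ → State K}
    (hc : ∀ k, IsIsolated p (c k).F ∧ Step0 p (c k) (c (k + 1))) {k₀ : ℕ} (hk₀ : 1 ≤ k₀)
    (hord : ordZero (c k₀).F = p)
    (he : ∀ k, k₀ ≤ k → Module.finrank K (additiveSubspace (initialForm (c k).F)) = 1) : False := by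
  obtain ⟨j, b, hw⟩ := FreeTail.exists_witnesses (K := K) fun k => (hc k).2
  obtain ⟨k, hk⟩ := hFT K c j b k₀ hw (forall_not_isSatellite_of_finrank_eq_one p hw hk₀ hord he)
  exact hk (hc k).1

/-- **F4-I(3,3) ⟸ FT(3,3) ∧ E2(3,3)**: the band is `FreeTail.noIsolatedBandRun3_of_charP hFT shapeLemma3`;
on the cone `ē` stabilises at `1` or `2` (`Directrix.isolated_cone_chain_eventually_one_or_two`);
`ē ≡ 1` is excluded by FT (`no_isolated_cone_chain_one_of_freeTail`), `ē ≡ 2` by E2 applied to the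
shifted chain. [OURS · conditional on FT and E2] [cite: CossartJannsenSaito2020, Cor. 5.37 and Thm. 5.40] -/
theorem noIsolatedTrap_three_three_of_freeTail_and_coneTwo (hFT : FreeTail.NoIsolatedFreeTailAt 3 3)
    (hE2 : ∀ (K : Type) [Field K] [CharP K 3] [DecidableEq K],
      ¬ ∃ c : ℕ → State K, ∀ k, IsIsolated 3 (c k).F ∧ Step0 3 (c k) (c (k + 1)) ∧
        ordZero (c k).F = (3 : ℕ∞) ∧ Module.finrank K (additiveSubspace (initialForm (c k).F)) = 2) :
    NoIsolatedTrap 3 3 := by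
  refine noIsolatedTrap_three_three_of_band_and_cone
    (FreeTail.noIsolatedBandRun3_of_charP hFT FreeTail.shapeLemma3) ?_
  intro K _ _ _
  rintro ⟨c, hc⟩
  haveI : Fact (Nat.Prime 3) := ⟨Nat.prime_three⟩
  obtain ⟨N, e, hN1, he12, hN⟩ := Directrix.isolated_cone_chain_eventually_one_or_two hc
  rcases he12 with rfl | rfl
  · exact no_isolated_cone_chain_one_of_freeTail 3 hFT (c := c) (fun k => ⟨(hc k).1, (hc k).2.1⟩) hN1
      (by exact_mod_cast (hc N).2.2) hN
  · exact hE2 K ⟨fun k => c (N + k), fun k => ⟨(hc (N + k)).1, (hc (N + k)).2.1, (hc (N + k)).2.2,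
      hN (N + k) (Nat.le_add_right N k)⟩⟩

/-- **Conversely** both FT(3,3) and E2(3,3) are special cases of `NoIsolatedTrap 3 3` (a witnessed chain
is a `Step0` chain). [OURS] -/
theorem freeTail_and_coneTwo_of_noIsolatedTrap_three_three (h : NoIsolatedTrap 3 3) :
    FreeTail.NoIsolatedFreeTailAt 3 3 ∧
      ∀ (K : Type) [Field K] [CharP K 3] [DecidableEq K],
        ¬ ∃ c : ℕ → State K, ∀ k, IsIsolated 3 (c k).F ∧ Step0 3 (c k) (c (k + 1)) ∧
          ordZero (c k).F = (3 : ℕ∞) ∧ Module.finrank K (additiveSubspace (initialForm (c k).F)) = 2 := by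
  constructor
  · intro K _ _ _ c j b k₀ hw _
    by_contra hall
    push Not at hall
    exact h K ⟨c, fun k => ⟨hall k, step0_of_isWitnessedChain hw k⟩⟩
  · intro K _ _ _
    rintro ⟨c, hc⟩
    exact h K ⟨c, fun k => ⟨(hc k).1, (hc k).2.1⟩⟩

/-- **`NoIsolatedTrap 3 3 ⟺ FT(3,3) ∧ E2(3,3)`** — the exact residual of F4-I(3,3) in the tree:
the free-tail lemma (CARD I-7-2, band AND `e = 1` cone) and the `e = ē = 2` cone chains
([CJS 2020] Thm. 5.40's territory). [OURS] [cite: CossartJannsenSaito2020, Thm. 5.40] -/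
theorem noIsolatedTrap_three_three_iff_freeTail_and_coneTwo :
    NoIsolatedTrap 3 3 ↔ FreeTail.NoIsolatedFreeTailAt 3 3 ∧
      ∀ (K : Type) [Field K] [CharP K 3] [DecidableEq K],
        ¬ ∃ c : ℕ → State K, ∀ k, IsIsolated 3 (c k).F ∧ Step0 3 (c k) (c (k + 1)) ∧
          ordZero (c k).F = (3 : ℕ∞) ∧ Module.finrank K (additiveSubspace (initialForm (c k).F)) = 2 :=
  ⟨freeTail_and_coneTwo_of_noIsolatedTrap_three_three,
    fun h => noIsolatedTrap_three_three_of_freeTail_and_coneTwo h.1 h.2⟩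

end IsolatedBand

end Summit.ResolutionOfSingularities.ResolutionOfSingularities.Theorems.PIDim4
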